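import Summits.QuantumFields.BalabanUV.T4Continuum.Spine.NE3.PairLandauB8Avg
import Summits.QuantumFields.BalabanUV.T4Continuum.Support.NE7MultiplierAnnihilatesGaugeDirections
import Summits.QuantumFields.BalabanUV.T4Continuum.Support.AveragingDeficitMultiLevelBridge
import HarnessLib

/-!
# NE7FramedEqualsStrippedGauged — THE FRAMED `(j+1)`-FOLD AVERAGE OF A CHART POINT IS THE GAUGE TRANSFORM, BY THE ACCUMULATED FRAME, OF THE STRIPPED (DOUBLE-BAR) TOWER TIMES THE DATUM,
# AND THE CONSTRAINED MINIMAL ACTION DOES NOT SEE THE DIFFERENCE (lineage `b2b-balaban-t4-ne7-p1`, gen 119, file H5 = the core of ROAD-G119 §5 S1)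

Cell `pub-balaban`, rung (B)+1 sub-cell t4, CRUX PROVER NE7 #1 (OWNER of row NE7), generation 119.
WHY (memo ROAD-G119 §2(a)(b)).  The route «(G′) via the stripped tower» computes the multiplier term of the bordered Hessian ✓ p828683 through the constraint map
`Ψ(Φ) = skewPR(log(V₀⁻¹·(U̿^{j+1}(Φ)·V₀)))` instead of `G(Φ) = levelQ(chart_{U♯}Φ)` (✓ H3 `NE7StrippedConstraintSocket`, hypothesis `m∘G = m∘Ψ`).  THIS FILE supplies the two facts behind
`m∘G = m∘Ψ` at the level of CONFIGURATIONS: (1) [Balaban1985Averaging] (88)/(92)/(97) — IN THE TREE as the formal identity ✓ `B7Eq92Concrete.avgIter_mul_eq_gaugeAct` — read for the tree's chart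
and iterated average: `cavgIter L (j+1) (chart_{U♯} Φ) = (U̿^{j+1}(Φ) · cavgIter L (j+1) U♯)^{v_{j+1}(Φ)}` with `U̿^{j+1}(Φ) = dbavgCovIter L U♯ (relPert U♯ Φ̃) (j+1)` the `(j+1)`-fold DOUBLE-BAR
average (90)–(91) and `v_{j+1}(Φ) = vcov L U♯ (relPert U♯ Φ̃) (j+1)` the accumulated frame (97) (`relPert U♯ Φ̃ · U♯ = chart_{U♯} Φ`, ✓ `Spine/NE3/PairLandauB8Avg.relPert_mul_eq_vary`); (2) the
constrained minimal action is invariant under unitary `N`-periodic gauge transformations of the datum (✓ `NE7MultiplierAnnihilatesGaugeDirections.minAct_gaugeAct_corner`), hence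
`minAct(cavgIter L (j+1) (chart_{U♯}Φ)) = minAct(U̿^{j+1}(Φ) · V₀)` whenever `v_{j+1}(Φ)` is unitary and `N`-periodic (both hold in the regime of [Balaban1985Averaging] Prop. 4 —
✓ `B8Prop7AdmittedFamily.dbavgCovIter_vcov_mem_unitaryUnits`, ✓ `Spine/NE3/FrameNormalisationAdmissibleTop.vcov_add_period`; DISPLAYED here).
WHAT ([folklore]; 0 def, 0 sorry; general `d`): `chart_eq_relPert_mul`; **`cavgIter_chart_eq_gaugeAct_stripped`** ((1), a formal identity: any `L`, `j`, `U♯`, `Φ`); **`minAct_cavgIter_chart_eq_stripped`**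
((2)).
HONEST FRAMING (page 1): (1) is bookkeeping over a landed formal identity, (2) a one-line consequence of a landed invariance; unitarity∕periodicity of the accumulated frame are HYPOTHESES here;
nothing of Bałaban's asserted ((88)–(92), (97) context only); NOT (G′), NOT NE7 as a spine node; spine 0∕9; finite T⁴ rung (B)+1 — NOT infinite volume, NOT mass gap, NOT BetaPertH, NOT Clay.
-/

set_option autoImplicit false

open scoped BigOperators Matrix Matrix.Norms.L2Operator Topology

namespace Summit.QuantumFields.BalabanUV.T4Continuum.NE7FramedEqualsStrippedGauged

open Literature.MathematicalPhysics.QuantumFieldTheory.Balaban1983to89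
open B7Prop1Explicit B7Prop2Explicit
open B7Eq92Concrete (dbavgCovIter vcov avgIter_mul_eq_gaugeAct)
open T4AveragingDeficitWall (vary)
open AveragingDeficitTorusChart (TDir chart chartDir chart_smul)
open AveragingDeficitMultiLevelPrep (cavgIter LevelSmall)
open AveragingDeficitMultiLevelBridge (cavgIter_eq_avgIter)
open MinimalActionSandwich (minAct)
open MinimalActionRate (sfClass)
open NE3EnergyShapes (IsUnitarySite IsPeriodicSite)
open NE3.PairLandauB8Avg (relPert relPert_mul_eq_vary)
open NE7MultiplierAnnihilatesGaugeDirections (minAct_gaugeAct_corner)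

noncomputable section

variable {d : ℕ} {n : Type} [Fintype n] [DecidableEq n]

/-- **THE CHART POINT IS THE LEFT PERTURBATION TIMES THE BASE**: `chart_id M W Φ = relPert W Φ̃ · W` (pointwise product of unit configurations), `Φ̃ = chartDir id M Φ`. [folklore] -/
theorem chart_eq_relPert_mul {M : ℕ} [NeZero M] (W : Site d → Fin d → (Matrix n n ℂ)ˣ) (Φ : TDir d n M) :
    chart (ContinuousLinearMap.id ℝ (Matrix n n ℂ)) M W Φ
      = relPert W (chartDir (ContinuousLinearMap.id ℝ (Matrix n n ℂ)) M Φ) * W := by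
  have h1 : chart (ContinuousLinearMap.id ℝ (Matrix n n ℂ)) M W Φ = vary W (chartDir (ContinuousLinearMap.id ℝ (Matrix n n ℂ)) M Φ) 1 := by
    rw [← chart_smul, one_smul]
  rw [h1, ← relPert_mul_eq_vary]
  rfl

/-- **[Balaban1985Averaging] (92)/(97) FOR THE TREE'S ITERATED AVERAGE OF A CHART POINT** (formal identity; any `L`, `j`, `U♯`, `Φ`):
`cavgIter L (j+1) (chart_{U♯} Φ) = gaugeAct (vcov L U♯ (relPert U♯ Φ̃) (j+1)) (dbavgCovIter L U♯ (relPert U♯ Φ̃) (j+1) · cavgIter L (j+1) U♯)`. [cite: Balaban1985Averaging, (92) p.31, (97) p.32] -/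
theorem cavgIter_chart_eq_gaugeAct_stripped {M : ℕ} [NeZero M] (L j : ℕ) (Us : Site d → Fin d → (Matrix n n ℂ)ˣ) (Φ : TDir d n M) :
    cavgIter L (j + 1) (chart (ContinuousLinearMap.id ℝ (Matrix n n ℂ)) M Us Φ)
      = gaugeAct (vcov L Us (relPert Us (chartDir (ContinuousLinearMap.id ℝ (Matrix n n ℂ)) M Φ)) (j + 1))
          (dbavgCovIter L Us (relPert Us (chartDir (ContinuousLinearMap.id ℝ (Matrix n n ℂ)) M Φ)) (j + 1) * cavgIter L (j + 1) Us) := by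
  rw [chart_eq_relPert_mul, cavgIter_eq_avgIter, cavgIter_eq_avgIter, avgIter_mul_eq_gaugeAct]

/-- **THE CONSTRAINED MINIMAL ACTION OF THE FRAMED AVERAGE EQUALS THAT OF THE STRIPPED CONFIGURATION**: for `L ≥ 1`, `ε ≥ 0`, the class smallness `LevelSmall d L j (ε∕(L^{j+1})²)`, and a
chart point `Φ` whose accumulated frame `v_{j+1}(Φ)` is unitary and `N`-periodic:
`minAct (cavgIter L (j+1) (chart_{U♯}Φ)) = minAct (dbavgCovIter L U♯ (relPert U♯ Φ̃) (j+1) · cavgIter L (j+1) U♯)`. [folklore] -/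
theorem minAct_cavgIter_chart_eq_stripped [Nonempty n] {L N M : ℕ} [NeZero M] (hL : 1 ≤ L) {ε : ℝ} (hε : 0 ≤ ε) (j : ℕ)
    (hs : LevelSmall d L j (ε / ((L : ℝ) ^ (j + 1)) ^ 2)) (Us : Site d → Fin d → (Matrix n n ℂ)ˣ) (Φ : TDir d n M)
    (hvU : IsUnitarySite (vcov L Us (relPert Us (chartDir (ContinuousLinearMap.id ℝ (Matrix n n ℂ)) M Φ)) (j + 1)))
    (hvP : IsPeriodicSite (vcov L Us (relPert Us (chartDir (ContinuousLinearMap.id ℝ (Matrix n n ℂ)) M Φ)) (j + 1)) (N : ℤ)) :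
    minAct d (sfClass d L N ε) L N (j + 1) (cavgIter L (j + 1) (chart (ContinuousLinearMap.id ℝ (Matrix n n ℂ)) M Us Φ))
      = minAct d (sfClass d L N ε) L N (j + 1)
          (dbavgCovIter L Us (relPert Us (chartDir (ContinuousLinearMap.id ℝ (Matrix n n ℂ)) M Φ)) (j + 1) * cavgIter L (j + 1) Us) := by
  rw [cavgIter_chart_eq_gaugeAct_stripped]
  exact minAct_gaugeAct_corner hL hε j hs _ hvU hvP

end

end Summit.QuantumFields.BalabanUV.T4Continuum.NE7FramedEqualsStrippedGauged
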